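import Literature.NumberTheory.EllipticCurves.BhargavaShankarCountingProofs
import Literature.NumberTheory.EllipticCurves.BSDRankZeroDensity
import Literature.NumberTheory.QuadraticFields.ThreeTorsionMeanSquarefreeEuler
import HarnessLib

/-!
# Bhargava–Skinner–Zhang §3.1–3.2: the height density of a family of curves defined by
# congruence conditions at one prime (the local-density formula), and Lemma 17 (proved)

`Proofs` companion of `Literature/NumberTheory/EllipticCurves/LeadingTerm.lean` (bsd.S27,
`Literature.NumberTheory.EllipticCurves.bhargava_skinner_zhang`), continuing
`LeadingTermBSZProofs` / `LeadingTermBSZAssemblyProofs`. Source: M. Bhargava, C. Skinner,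
W. Zhang, *A majority of elliptic curves over `ℚ` satisfy the Birch and Swinnerton-Dyer
conjecture*, arXiv:1407.1826 (2014), §3.1 ("by [BS2] the density `μ(F)` equals the product of the
local densities `μ_ℓ(F)` over all primes `ℓ`, where `μ_ℓ(F) = μ_ℓ(Σ_ℓ)` equals the measure of
`Σ_ℓ ⊂ ℤ_ℓ²` divided by `1 - ℓ⁻¹⁰`; here `1 - ℓ⁻¹⁰` is the measure of the set of `(A,B) ∈ ℤ_ℓ²`
such that `ℓ⁶ ∤ B` whenever `ℓ⁴ ∣ A`") and Lemma 17 (`μ(S₀(5)) = 4·5¹⁰/(5(5¹⁰-1))`, the condition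
being `5 ∤ A`). Everything here is PROVED (no named facts):

* `Literature.NumberTheory.EllipticCurves.hasHeightDensity_residues` — **the local-density
  formula at one prime**: for a prime `p`, `m ≥ 0` and a set `R` of residue pairs
  `(A, B) mod p^m` all of whose members have `p ∤ A`, the curves `E_{A,B}` with
  `(A, B) mod p^m ∈ R` have height density (`Literature.NumberTheory.EllipticCurves.HasHeightDensity`,
  proportion among all `E_{A,B}` of naive height `< X`, `X → ∞`) exactly
  `#R / p^{2m} / (1 - p⁻¹⁰)` — the `p`-adic measure of the residue set divided by `1 - p⁻¹⁰`, all other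
  local factors cancelling against those of the whole family (`p ∤ A` makes the minimality condition
  at `p` automatic). Proof (namespace `Literature.NumberTheory.EllipticCurves.HeightCount`, reusing the
  sieve of `BhargavaShankarCountingProofs`, i.e. of Bhargava–Shankar's Lemma 5.15): in the box
  `4|A|³ < X`, `27B² < X`, inclusion–exclusion over the primes `q ≤ Y` counts the pairs with the
  residue condition and no `q ≤ Y` with `q⁴ ∣ A`, `q⁶ ∣ B` as
  `#R·(2R₁/p^m)(2R₂/p^m)·∏_{q ≤ Y, q ≠ p}(1 - q⁻¹⁰) + O_{Y,R}(R₁ + R₂ + 1)` (the terms through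
  which `p` divides vanish because `p ∤ A` on `R`; for `D` coprime to `p` the conditions
  `D⁴ ∣ A`, `A ≡ a (p^m)` cut one residue class modulo `D⁴p^m` by the Chinese remainder theorem,
  counted in `(-R₁, R₁)` up to an error `≤ 2`); the pairs failing minimality only at a prime `> Y`
  and the degenerate pairs are `≤ 8R₁R₂/(Y+1) + O(X^{1/2})` exactly as in Lemma 5.15; let `X → ∞`,
  then `Y → ∞`, and divide by `#{E_{A,B} : H < X} ~ c_F X^{5/6}`
  (`card_heightFamilyBelow_asymptotic_holds`).
* `Literature.NumberTheory.EllipticCurves.hasHeightDensity_not_five_dvd` — **Lemma 17 of the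
  source, proved**: the curves `E_{A,B}` with `5 ∤ A` (the source's `S₀(5)`: good ordinary or
  multiplicative reduction at `5`, shown there to amount to `5 ∤ A`) have height density
  `4·5¹⁰/(5(5¹⁰ - 1)) (> .8)`.

These are the elementary density inputs of the assembly
`Literature.NumberTheory.EllipticCurves.heightDensityGE_satisfiesBSDRankLeOne_of_pieces`
(`LeadingTermBSZAssemblyProofs`): its pieces `S₀`, `T`, `R` are sets of residues modulo powers of `5`
inside `{5 ∤ A}`, whose densities are given by `hasHeightDensity_residues` once their residues are
counted.

## References

* M. Bhargava, C. Skinner, W. Zhang, arXiv:1407.1826 (2014), §3.1 and Lemma 17.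
  [cite: BhargavaSkinnerZhang2014, §3.1 and Lemma 17]
* M. Bhargava, A. Shankar, Ann. of Math. (2) 181 (2015) 191–242 = arXiv:1006.1002v2, Lemma 5.15 and
  §3.7 (the uniformity/sieve step "[BS2]" quoted by the source). [cite: BhargavaShankarAnnals2015, Lemma 5.15]
-/

noncomputable section

open scoped Classical
open Filter Topology

namespace Literature.NumberTheory.EllipticCurves

namespace HeightCount

/-! ## §A Residue classes in `intBall` -/

/-- `intBall R` is the integer interval `[-⌈R⌉ + 1, ⌈R⌉)`. [folklore] -/
theorem intBall_eq_Ico (R : ℝ) : intBall R = Finset.Ico (-⌈R⌉ + 1) ⌈R⌉ := by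
  ext k
  simp only [intBall, Finset.mem_Ioo, Finset.mem_Ico]
  omega

/-- **Counting a residue class in `(-R, R)`**: for `M > 0` the number of `k`, `|k| < R`, with
`k ≡ v (mod M)` differs from `2R/M` by at most `2`. [folklore] -/
theorem abs_card_filter_modEq_intBall_sub_le {R : ℝ} (hR : 0 < R) {M : ℤ} (hM : 0 < M) (v : ℤ) :
    |(((intBall R).filter (fun k ↦ k ≡ v [ZMOD M])).card : ℝ) - 2 * R / M| ≤ 2 := by
  have hc : 0 < ⌈R⌉ := Int.ceil_pos.mpr hR
  have hle : -⌈R⌉ + 1 ≤ ⌈R⌉ := by omega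
  have h1 := Literature.NumberTheory.QuadraticFields.abs_card_Ico_filter_modEq_sub_le hle hM v
  rw [intBall_eq_Ico]
  have hM' : (0 : ℝ) < M := by exact_mod_cast hM
  have hM1 : (1 : ℝ) ≤ M := by exact_mod_cast hM
  have hc1 := Int.le_ceil R
  have hc2 := Int.ceil_lt_add_one R
  have key : |(((⌈R⌉ : ℤ) : ℝ) - ((-⌈R⌉ + 1 : ℤ) : ℝ)) / M - 2 * R / M| ≤ 1 := by
    rw [← sub_div, abs_div, abs_of_pos hM', div_le_one hM']
    refine le_trans ?_ hM1
    push_cast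
    rw [abs_le]; constructor <;> linarith
  calc |(((Finset.Ico (-⌈R⌉ + 1) ⌈R⌉).filter (fun k ↦ k ≡ v [ZMOD M])).card : ℝ) - 2 * R / M|
      ≤ |(((Finset.Ico (-⌈R⌉ + 1) ⌈R⌉).filter (fun k ↦ k ≡ v [ZMOD M])).card : ℝ) -
            (((⌈R⌉ : ℤ) : ℝ) - ((-⌈R⌉ + 1 : ℤ) : ℝ)) / M| +
          |(((⌈R⌉ : ℤ) : ℝ) - ((-⌈R⌉ + 1 : ℤ) : ℝ)) / M - 2 * R / M| := abs_sub_le _ _ _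
    _ ≤ 1 + 1 := add_le_add h1 key
    _ = 2 := by norm_num

/-- **Chinese remainder count**: for `D` coprime to `N`, the number of `A`, `|A| < R`, with `D^k ∣ A`
and `A ≡ a (mod N)` differs from `2R/N/D^k` by at most `2` (the two conditions cut out one residue
class modulo `D^k N`). [folklore] -/
theorem abs_card_filter_dvd_and_modEq_sub_le {R : ℝ} (hR : 0 < R) {D N : ℕ} (hD : 0 < D)
    (hN : 0 < N) (hcop : D.Coprime N) (k : ℕ) (a : ℤ) :
    |(((intBall R).filter (fun A ↦ (D : ℤ) ^ k ∣ A ∧ A ≡ a [ZMOD N])).card : ℝ) -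
        2 * R / N / (D : ℝ) ^ k| ≤ 2 := by
  obtain ⟨c, hc0, hca⟩ :=
    Literature.NumberTheory.QuadraticFields.exists_modEq_and_modEq_of_coprime
      (Nat.Coprime.pow_left k hcop) 0 a
  have hc0' : c ≡ 0 [ZMOD (D : ℤ) ^ k] := by exact_mod_cast hc0
  have hcop' : ((D : ℤ) ^ k).natAbs.Coprime (N : ℤ).natAbs := by
    rw [Int.natAbs_pow, Int.natAbs_natCast, Int.natAbs_natCast]
    exact Nat.Coprime.pow_left k hcop
  have hiff : ∀ A : ℤ, ((D : ℤ) ^ k ∣ A ∧ A ≡ a [ZMOD N]) ↔ A ≡ c [ZMOD (D : ℤ) ^ k * N] := by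
    intro A
    rw [← Int.modEq_and_modEq_iff_modEq_mul hcop']
    constructor
    · rintro ⟨h1, h2⟩
      exact ⟨(Int.modEq_zero_iff_dvd.mpr h1).trans hc0'.symm, h2.trans hca.symm⟩
    · rintro ⟨h1, h2⟩
      exact ⟨Int.modEq_zero_iff_dvd.mp (h1.trans hc0'), h2.trans hca⟩
  have hM : (0 : ℤ) < (D : ℤ) ^ k * N := by positivity
  have key := abs_card_filter_modEq_intBall_sub_le hR hM c
  rw [Finset.filter_congr (fun A _ ↦ hiff A)]
  have hcast : 2 * R / (((D : ℤ) ^ k * N : ℤ) : ℝ) = 2 * R / N / (D : ℝ) ^ k := by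
    push_cast
    ring
  rwa [hcast] at key

/-- The same count with the residue condition phrased in `ZMod N`. [folklore] -/
theorem abs_card_filter_dvd_and_cast_eq_sub_le {R : ℝ} (hR : 0 < R) {D N : ℕ} (hD : 0 < D)
    (hN : 0 < N) (hcop : D.Coprime N) (k : ℕ) (a : ZMod N) :
    |(((intBall R).filter (fun A : ℤ ↦ (D : ℤ) ^ k ∣ A ∧ (A : ZMod N) = a)).card : ℝ) -
        2 * R / N / (D : ℝ) ^ k| ≤ 2 := by
  have h := abs_card_filter_dvd_and_modEq_sub_le hR hD hN hcop k (a.cast : ℤ)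
  have hiff : ∀ A : ℤ, ((A : ZMod N) = a) ↔ A ≡ (a.cast : ℤ) [ZMOD N] := by
    intro A
    rw [← ZMod.intCast_eq_intCast_iff, ZMod.intCast_zmod_cast]
  simp_rw [hiff]
  exact h

/-- Elementary: `|xy − uv| ≤ 2u + 2v + 4` when `|x − u| ≤ 2`, `|y − v| ≤ 2`, `u, y ≥ 0`. [folklore] -/
theorem abs_mul_sub_mul_le_two {x y u v : ℝ} (hx : |x - u| ≤ 2) (hy : |y - v| ≤ 2) (hu : 0 ≤ u)
    (hy0 : 0 ≤ y) : |x * y - u * v| ≤ 2 * u + 2 * v + 4 := by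
  have hyv : y ≤ v + 2 := by linarith [(abs_le.mp hy).2]
  calc |x * y - u * v| = |(x - u) * y + u * (y - v)| := by ring_nf
    _ ≤ |(x - u) * y| + |u * (y - v)| := abs_add_le _ _
    _ = |x - u| * y + u * |y - v| := by
        rw [abs_mul, abs_mul, abs_of_nonneg hy0, abs_of_nonneg hu]
    _ ≤ 2 * y + u * 2 := by gcongr
    _ ≤ 2 * u + 2 * v + 4 := by linarith

/-! ## §B Pairs in the box with a divisibility and a residue condition -/

/-- For `D` coprime to `N` and one residue pair `r` modulo `N`: the pairs `(A, B)` in the box with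
`D⁴ ∣ A`, `D⁶ ∣ B`, `(A, B) ≡ r (mod N)` number `(2R₁/N/D⁴)(2R₂/N/D⁶)` up to
`2(2R₁/N/D⁴) + 2(2R₂/N/D⁶) + 4`. [folklore] -/
theorem abs_card_filter_dvdCond_and_eq_sub_le {X : ℕ} (hX : 1 ≤ X) {D N : ℕ} (hD : 0 < D)
    (hN : 0 < N) (hcop : D.Coprime N) (r : ZMod N × ZMod N) :
    |(((box X).filter (fun AB ↦ DvdCond D AB ∧
          ((AB.1 : ZMod N), (AB.2 : ZMod N)) = r)).card : ℝ) -
        (2 * R₁ X / N / (D : ℝ) ^ 4) * (2 * R₂ X / N / (D : ℝ) ^ 6)| ≤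
      2 * (2 * R₁ X / N / (D : ℝ) ^ 4) + 2 * (2 * R₂ X / N / (D : ℝ) ^ 6) + 4 := by
  have key : (box X).filter (fun AB ↦ DvdCond D AB ∧ ((AB.1 : ZMod N), (AB.2 : ZMod N)) = r) =
      (intBall (R₁ X)).filter (fun A : ℤ ↦ (D : ℤ) ^ 4 ∣ A ∧ (A : ZMod N) = r.1) ×ˢ
        (intBall (R₂ X)).filter (fun B : ℤ ↦ (D : ℤ) ^ 6 ∣ B ∧ (B : ZMod N) = r.2) := by
    ext ⟨A, B⟩
    simp only [box, DvdCond, Finset.mem_filter, Finset.mem_product, Prod.ext_iff]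
    tauto
  rw [key, Finset.card_product, Nat.cast_mul]
  have h1 := abs_card_filter_dvd_and_cast_eq_sub_le (R₁_pos hX) hD hN hcop 4 r.1
  have h2 := abs_card_filter_dvd_and_cast_eq_sub_le (R₂_pos hX) hD hN hcop 6 r.2
  have hu : 0 ≤ 2 * R₁ X / N / (D : ℝ) ^ 4 := by
    have := R₁_pos hX; positivity
  exact abs_mul_sub_mul_le_two h1 h2 hu (Nat.cast_nonneg _)

/-- For `D` coprime to `N` and a set `R` of residue pairs modulo `N`: the pairs in the box with
`D⁴ ∣ A`, `D⁶ ∣ B`, `(A, B) mod N ∈ R` number `#R·(2R₁/N/D⁴)(2R₂/N/D⁶)` up to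
`#R·(2(2R₁/N/D⁴) + 2(2R₂/N/D⁶) + 4)` (sum over the residue pairs). [folklore] -/
theorem abs_card_filter_dvdCond_and_mem_sub_le {X : ℕ} (hX : 1 ≤ X) {D N : ℕ} (hD : 0 < D)
    (hN : 0 < N) (hcop : D.Coprime N) (R : Finset (ZMod N × ZMod N)) :
    |(((box X).filter (fun AB ↦ DvdCond D AB ∧
          ((AB.1 : ZMod N), (AB.2 : ZMod N)) ∈ R)).card : ℝ) -
        R.card * ((2 * R₁ X / N / (D : ℝ) ^ 4) * (2 * R₂ X / N / (D : ℝ) ^ 6))| ≤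
      R.card * (2 * (2 * R₁ X / N / (D : ℝ) ^ 4) + 2 * (2 * R₂ X / N / (D : ℝ) ^ 6) + 4) := by
  set s := (box X).filter (fun AB ↦ DvdCond D AB ∧ ((AB.1 : ZMod N), (AB.2 : ZMod N)) ∈ R)
    with hs
  have hmaps : (s : Set (ℤ × ℤ)).MapsTo (fun AB : ℤ × ℤ ↦ ((AB.1 : ZMod N), (AB.2 : ZMod N))) R := by
    intro AB hAB
    have hAB' : AB ∈ s := hAB
    rw [hs, Finset.mem_filter] at hAB'
    exact hAB'.2.2
  have hfib := Finset.card_eq_sum_card_fiberwise hmaps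
  have hfib' : ∀ r ∈ R, s.filter (fun AB ↦ ((AB.1 : ZMod N), (AB.2 : ZMod N)) = r) =
      (box X).filter (fun AB ↦ DvdCond D AB ∧ ((AB.1 : ZMod N), (AB.2 : ZMod N)) = r) := by
    intro r hr
    rw [hs, Finset.filter_filter]
    refine Finset.filter_congr fun AB _ ↦ ?_
    constructor
    · rintro ⟨⟨h1, _⟩, h2⟩; exact ⟨h1, h2⟩
    · rintro ⟨h1, h2⟩; exact ⟨⟨h1, h2 ▸ hr⟩, h2⟩
  rw [hfib, Finset.sum_congr rfl (fun r hr ↦ by rw [hfib' r hr]), Nat.cast_sum]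
  have e1 : (R.card : ℝ) * ((2 * R₁ X / N / (D : ℝ) ^ 4) * (2 * R₂ X / N / (D : ℝ) ^ 6)) =
      ∑ r ∈ R, ((2 * R₁ X / N / (D : ℝ) ^ 4) * (2 * R₂ X / N / (D : ℝ) ^ 6)) := by
    rw [Finset.sum_const, nsmul_eq_mul]
  have e2 : (R.card : ℝ) * (2 * (2 * R₁ X / N / (D : ℝ) ^ 4) + 2 * (2 * R₂ X / N / (D : ℝ) ^ 6) + 4)
      = ∑ r ∈ R, (2 * (2 * R₁ X / N / (D : ℝ) ^ 4) + 2 * (2 * R₂ X / N / (D : ℝ) ^ 6) + 4) := by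
    rw [Finset.sum_const, nsmul_eq_mul]
  rw [e1, e2, ← Finset.sum_sub_distrib]
  refine (Finset.abs_sum_le_sum_abs _ _).trans ?_
  exact Finset.sum_le_sum fun r _ ↦ abs_card_filter_dvdCond_and_eq_sub_le hX hD hN hcop r

/-! ## §C Inclusion–exclusion with a residue condition -/

/-- Inclusion–exclusion count of the truncated family cut by a residue condition modulo `n`. [folklore] -/
theorem card_filter_minimalLE_and_mem (X Y : ℕ) {n : ℕ} (R : Finset (ZMod n × ZMod n)) :
    (((box X).filter (fun AB ↦ MinimalLE Y AB ∧
        ((AB.1 : ZMod n), (AB.2 : ZMod n)) ∈ R)).card : ℝ) =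
      ∑ t ∈ (Nat.primesLE Y).powerset, (-1 : ℝ) ^ t.card *
        (((box X).filter (fun AB ↦ DvdCond (∏ p ∈ t, p) AB ∧
          ((AB.1 : ZMod n), (AB.2 : ZMod n)) ∈ R)).card : ℝ) := by
  rw [Finset.natCast_card_filter]
  have hind : ∀ AB : ℤ × ℤ, (if MinimalLE Y AB ∧ ((AB.1 : ZMod n), (AB.2 : ZMod n)) ∈ R
      then (1 : ℝ) else 0) =
      ∑ t ∈ (Nat.primesLE Y).powerset, (-1 : ℝ) ^ t.card *
        (if DvdCond (∏ p ∈ t, p) AB ∧ ((AB.1 : ZMod n), (AB.2 : ZMod n)) ∈ R then 1 else 0) := by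
    intro AB
    by_cases hQ : ((AB.1 : ZMod n), (AB.2 : ZMod n)) ∈ R
    · simp only [hQ, and_true]
      exact indicator_minimalLE Y AB
    · simp [hQ]
  simp_rw [hind]
  rw [Finset.sum_comm]
  refine Finset.sum_congr rfl fun t _ ↦ ?_
  rw [Finset.natCast_card_filter, Finset.mul_sum]

/-- The main term over an arbitrary finite set of positive integers `S`:
`Σ_{t ⊆ S} (−1)^{|t|} (c₁/D_t⁴)(c₂/D_t⁶) = c₁ c₂ ∏_{q ∈ S} (1 − q⁻¹⁰)`. [folklore] -/
theorem mainTerm_eq_of_pos (S : Finset ℕ) (hS : ∀ q ∈ S, 0 < q) (c₁ c₂ : ℝ) :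
    ∑ t ∈ S.powerset, (-1 : ℝ) ^ t.card *
        ((c₁ / ((∏ q ∈ t, q : ℕ) : ℝ) ^ 4) * (c₂ / ((∏ q ∈ t, q : ℕ) : ℝ) ^ 6)) =
      c₁ * c₂ * ∏ q ∈ S, (1 - 1 / (q : ℝ) ^ 10) := by
  have hrhs : ∏ q ∈ S, (1 - 1 / (q : ℝ) ^ 10) = ∏ q ∈ S, (-(1 / (q : ℝ) ^ 10) + 1) :=
    Finset.prod_congr rfl fun q _ ↦ by ring
  rw [hrhs, Finset.prod_add, Finset.mul_sum]
  refine Finset.sum_congr rfl fun t ht ↦ ?_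
  rw [Finset.prod_const_one, mul_one, Finset.prod_neg, Finset.prod_div_distrib,
    Finset.prod_const_one, Finset.prod_pow, Nat.cast_prod]
  have hpos : (0 : ℝ) < ∏ q ∈ t, (q : ℝ) := by
    refine Finset.prod_pos fun q hq ↦ ?_
    rw [Finset.mem_powerset] at ht
    exact_mod_cast hS q (ht hq)
  field_simp

/-- **The truncated count with a residue condition at `p`.** For a prime `p`, a set `R` of residue
pairs modulo `p^m` all with `p ∤ A`, and any `Y`: the pairs in the box with `(A, B) mod p^m ∈ R` and
no prime `q ≤ Y` with `q⁴ ∣ A`, `q⁶ ∣ B` number `#R (2R₁/p^m)(2R₂/p^m) ∏_{q ≤ Y, q ≠ p} (1 − q⁻¹⁰)`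
up to `2^{π(Y)} #R (4R₁ + 4R₂ + 4)`. [folklore] -/
theorem abs_card_filter_minimalLE_and_mem_sub_le {X : ℕ} (hX : 1 ≤ X) (Y : ℕ) {p : ℕ}
    (hp : p.Prime) (m : ℕ) (R : Finset (ZMod (p ^ m) × ZMod (p ^ m)))
    (hR : ∀ AB : ℤ × ℤ, ((AB.1 : ZMod (p ^ m)), (AB.2 : ZMod (p ^ m))) ∈ R → ¬ (p : ℤ) ∣ AB.1) :
    |(((box X).filter (fun AB ↦ MinimalLE Y AB ∧
          ((AB.1 : ZMod (p ^ m)), (AB.2 : ZMod (p ^ m))) ∈ R)).card : ℝ) -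
        R.card * (2 * R₁ X / (p ^ m : ℕ)) * (2 * R₂ X / (p ^ m : ℕ)) *
          ∏ q ∈ (Nat.primesLE Y).erase p, (1 - 1 / (q : ℝ) ^ 10)| ≤
      2 ^ (Nat.primesLE Y).card * (R.card * (4 * R₁ X + 4 * R₂ X + 4)) := by
  have hR₁ := R₁_pos hX
  have hR₂ := R₂_pos hX
  have hN : 0 < p ^ m := pow_pos hp.pos m
  set S := Nat.primesLE Y with hSdef
  -- the terms through which `p` divides vanish
  have hzero : ∀ t ∈ S.powerset, t ∉ (S.erase p).powerset →
      (-1 : ℝ) ^ t.card * (((box X).filter (fun AB ↦ DvdCond (∏ q ∈ t, q) AB ∧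
        ((AB.1 : ZMod (p ^ m)), (AB.2 : ZMod (p ^ m))) ∈ R)).card : ℝ) = 0 := by
    intro t ht hnt
    rw [Finset.mem_powerset] at ht hnt
    rw [Finset.subset_erase] at hnt
    have hpt : p ∈ t := by
      by_contra h
      exact hnt ⟨ht, h⟩
    have hempty : (box X).filter (fun AB ↦ DvdCond (∏ q ∈ t, q) AB ∧
        ((AB.1 : ZMod (p ^ m)), (AB.2 : ZMod (p ^ m))) ∈ R) = ∅ := by
      refine Finset.filter_false_of_mem fun AB _ ↦ ?_
      rintro ⟨⟨hA, _⟩, hmem⟩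
      refine hR AB hmem ?_
      have h0 : p ∣ ∏ q ∈ t, q := Finset.dvd_prod_of_mem (fun q : ℕ ↦ q) hpt
      have h1 : (p : ℤ) ∣ ((∏ q ∈ t, q : ℕ) : ℤ) := Int.natCast_dvd_natCast.mpr h0
      exact (h1.trans (dvd_pow_self _ (by norm_num))).trans hA
    rw [hempty, Finset.card_empty, Nat.cast_zero, mul_zero]
  rw [card_filter_minimalLE_and_mem,
    ← Finset.sum_subset (Finset.powerset_mono.mpr (Finset.erase_subset p S)) hzero]
  -- main term over `S.erase p`
  have hSpos : ∀ q ∈ S.erase p, 0 < q := fun q hq ↦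
    (Nat.mem_primesLE.mp (Finset.mem_of_mem_erase hq)).2.pos
  have hmain := mainTerm_eq_of_pos (S.erase p) hSpos (2 * R₁ X / (p ^ m : ℕ)) (2 * R₂ X / (p ^ m : ℕ))
  have hmain' : (R.card : ℝ) * (2 * R₁ X / (p ^ m : ℕ)) * (2 * R₂ X / (p ^ m : ℕ)) *
      ∏ q ∈ S.erase p, (1 - 1 / (q : ℝ) ^ 10) =
      ∑ t ∈ (S.erase p).powerset, (-1 : ℝ) ^ t.card * ((R.card : ℝ) *
        ((2 * R₁ X / (p ^ m : ℕ) / ((∏ q ∈ t, q : ℕ) : ℝ) ^ 4) *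
          (2 * R₂ X / (p ^ m : ℕ) / ((∏ q ∈ t, q : ℕ) : ℝ) ^ 6))) := by
    have : ∀ t ∈ (S.erase p).powerset, (-1 : ℝ) ^ t.card * ((R.card : ℝ) *
        ((2 * R₁ X / (p ^ m : ℕ) / ((∏ q ∈ t, q : ℕ) : ℝ) ^ 4) *
          (2 * R₂ X / (p ^ m : ℕ) / ((∏ q ∈ t, q : ℕ) : ℝ) ^ 6)))
        = (R.card : ℝ) * ((-1 : ℝ) ^ t.card *
          ((2 * R₁ X / (p ^ m : ℕ) / ((∏ q ∈ t, q : ℕ) : ℝ) ^ 4) *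
            (2 * R₂ X / (p ^ m : ℕ) / ((∏ q ∈ t, q : ℕ) : ℝ) ^ 6))) :=
      fun t _ ↦ by ring
    rw [Finset.sum_congr rfl this, ← Finset.mul_sum, hmain]
    ring
  rw [hmain', ← Finset.sum_sub_distrib]
  refine (Finset.abs_sum_le_sum_abs _ _).trans ?_
  -- termwise error
  have hterm : ∀ t ∈ (S.erase p).powerset,
      |(-1 : ℝ) ^ t.card * (((box X).filter (fun AB ↦ DvdCond (∏ q ∈ t, q) AB ∧
          ((AB.1 : ZMod (p ^ m)), (AB.2 : ZMod (p ^ m))) ∈ R)).card : ℝ) -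
        (-1 : ℝ) ^ t.card * ((R.card : ℝ) *
          ((2 * R₁ X / (p ^ m : ℕ) / ((∏ q ∈ t, q : ℕ) : ℝ) ^ 4) *
            (2 * R₂ X / (p ^ m : ℕ) / ((∏ q ∈ t, q : ℕ) : ℝ) ^ 6)))|
        ≤ R.card * (4 * R₁ X + 4 * R₂ X + 4) := by
    intro t ht
    rw [Finset.mem_powerset] at ht
    have htS : ∀ q ∈ t, q ∈ S ∧ q ≠ p := fun q hq ↦
      ⟨Finset.mem_of_mem_erase (ht hq), Finset.ne_of_mem_erase (ht hq)⟩
    have hD : 0 < ∏ q ∈ t, q := Finset.prod_pos fun q hq ↦ hSpos q (ht hq)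
    have hcop : (∏ q ∈ t, q).Coprime (p ^ m) := by
      refine Nat.Coprime.pow_right m (Nat.Coprime.prod_left fun q hq ↦ ?_)
      exact (Nat.coprime_primes (Nat.mem_primesLE.mp (htS q hq).1).2 hp).mpr (htS q hq).2
    rw [← mul_sub, abs_mul, abs_pow, abs_neg, abs_one, one_pow, one_mul]
    refine (abs_card_filter_dvdCond_and_mem_sub_le hX hD hN hcop R).trans ?_
    have hDR : (1 : ℝ) ≤ ((∏ q ∈ t, q : ℕ) : ℝ) := by
      exact_mod_cast Nat.one_le_iff_ne_zero.mpr hD.ne'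
    set Dr : ℝ := ((∏ q ∈ t, q : ℕ) : ℝ) with hDr
    have hNR : (1 : ℝ) ≤ ((p ^ m : ℕ) : ℝ) := by exact_mod_cast hN
    have hD4 : (1 : ℝ) ≤ Dr ^ 4 := one_le_pow₀ hDR
    have hD6 : (1 : ℝ) ≤ Dr ^ 6 := one_le_pow₀ hDR
    have e1 : 2 * R₁ X / ((p ^ m : ℕ) : ℝ) / Dr ^ 4 ≤ 2 * R₁ X := by
      rw [div_div]
      exact div_le_self (by positivity) (one_le_mul_of_one_le_of_one_le hNR hD4)
    have e2 : 2 * R₂ X / ((p ^ m : ℕ) : ℝ) / Dr ^ 6 ≤ 2 * R₂ X := by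
      rw [div_div]
      exact div_le_self (by positivity) (one_le_mul_of_one_le_of_one_le hNR hD6)
    have hRc : (0 : ℝ) ≤ R.card := Nat.cast_nonneg _
    refine mul_le_mul_of_nonneg_left ?_ hRc
    linarith
  refine (Finset.sum_le_sum hterm).trans ?_
  rw [Finset.sum_const, Finset.card_powerset, nsmul_eq_mul]
  push_cast
  have hsub : (S.erase p).card ≤ S.card := Finset.card_erase_le
  have hpow : (2 : ℝ) ^ (S.erase p).card ≤ 2 ^ S.card := pow_le_pow_right₀ (by norm_num) hsub
  have hnonneg : (0 : ℝ) ≤ R.card * (4 * R₁ X + 4 * R₂ X + 4) := by positivity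
  exact mul_le_mul_of_nonneg_right hpow hnonneg

/-! ## §D Two-sided bounds for the family cut by a residue condition -/

/-- Two-sided estimate for `#{E_{A,B} : H < X, (A, B) mod n ∈ R}` against the truncated count cut
by the same condition: the members satisfy truncated minimality, and a truncated pair is a member,
degenerate, or fails minimality at a prime `> Y` (`filter_minimalLE_subset`). [folklore] -/
theorem card_heightFamilyBelow_filter_mem_bounds {X : ℕ} (hX : 1 ≤ X) {Y : ℕ} (hY : 1 ≤ Y)
    {n : ℕ} (R : Finset (ZMod n × ZMod n)) :
    (((heightFamilyBelow X).filter (fun AB ↦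
        ((AB.1 : ZMod n), (AB.2 : ZMod n)) ∈ R)).card : ℝ) ≤
        ((box X).filter (fun AB ↦ MinimalLE Y AB ∧
          ((AB.1 : ZMod n), (AB.2 : ZMod n)) ∈ R)).card ∧
      (((box X).filter (fun AB ↦ MinimalLE Y AB ∧
          ((AB.1 : ZMod n), (AB.2 : ZMod n)) ∈ R)).card : ℝ) - (2 * R₂ X + 1) -
          (8 * (R₁ X * R₂ X) / (Y + 1) + 2 * R₁ X + 2 * R₂ X) ≤
        ((heightFamilyBelow X).filter (fun AB ↦
          ((AB.1 : ZMod n), (AB.2 : ZMod n)) ∈ R)).card := by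
  constructor
  · have : (heightFamilyBelow X).filter (fun AB ↦ ((AB.1 : ZMod n), (AB.2 : ZMod n)) ∈ R) ⊆
        (box X).filter (fun AB ↦ MinimalLE Y AB ∧ ((AB.1 : ZMod n), (AB.2 : ZMod n)) ∈ R) := by
      intro AB hAB
      rw [Finset.mem_filter, heightFamilyBelow_eq, Finset.mem_filter] at hAB
      rw [Finset.mem_filter]
      exact ⟨hAB.1.1, fun p hp ↦ hAB.1.2.2 p (Nat.mem_primesLE.mp hp).2, hAB.2⟩
    exact_mod_cast Finset.card_le_card this
  · have hsub : (box X).filter (fun AB ↦ MinimalLE Y AB ∧ ((AB.1 : ZMod n), (AB.2 : ZMod n)) ∈ R) ⊆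
        (heightFamilyBelow X).filter (fun AB ↦ ((AB.1 : ZMod n), (AB.2 : ZMod n)) ∈ R) ∪
          ((box X).filter (fun AB : ℤ × ℤ ↦ 4 * AB.1 ^ 3 + 27 * AB.2 ^ 2 = 0) ∪
            (box X).filter (fun AB ↦ AB ≠ (0, 0) ∧ ∃ p, p.Prime ∧ Y < p ∧ DvdCond p AB)) := by
      intro AB hAB
      rw [Finset.mem_filter] at hAB
      obtain ⟨hbox, hmin, hQ⟩ := hAB
      have h := filter_minimalLE_subset X Y (Finset.mem_filter.mpr ⟨hbox, hmin⟩)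
      rw [Finset.mem_union, Finset.mem_union] at h ⊢
      rcases h with h | h
      · exact Or.inl (Finset.mem_filter.mpr ⟨h, hQ⟩)
      · exact Or.inr h
    have h1 := Finset.card_le_card hsub
    have h2 := Finset.card_union_le
      ((heightFamilyBelow X).filter (fun AB ↦ ((AB.1 : ZMod n), (AB.2 : ZMod n)) ∈ R))
      ((box X).filter (fun AB : ℤ × ℤ ↦ 4 * AB.1 ^ 3 + 27 * AB.2 ^ 2 = 0) ∪
        (box X).filter (fun AB ↦ AB ≠ (0, 0) ∧ ∃ p, p.Prime ∧ Y < p ∧ DvdCond p AB))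
    have h3 := Finset.card_union_le
      ((box X).filter (fun AB : ℤ × ℤ ↦ 4 * AB.1 ^ 3 + 27 * AB.2 ^ 2 = 0))
      ((box X).filter (fun AB ↦ AB ≠ (0, 0) ∧ ∃ p, p.Prime ∧ Y < p ∧ DvdCond p AB))
    have h : ((box X).filter (fun AB ↦ MinimalLE Y AB ∧
        ((AB.1 : ZMod n), (AB.2 : ZMod n)) ∈ R)).card ≤
        ((heightFamilyBelow X).filter (fun AB ↦ ((AB.1 : ZMod n), (AB.2 : ZMod n)) ∈ R)).card +
        ((((box X).filter (fun AB : ℤ × ℤ ↦ 4 * AB.1 ^ 3 + 27 * AB.2 ^ 2 = 0)).card) +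
          (((box X).filter
            (fun AB ↦ AB ≠ (0, 0) ∧ ∃ p, p.Prime ∧ Y < p ∧ DvdCond p AB)).card)) := by
      omega
    have h' : (((box X).filter (fun AB ↦ MinimalLE Y AB ∧
        ((AB.1 : ZMod n), (AB.2 : ZMod n)) ∈ R)).card : ℝ) ≤
        ((heightFamilyBelow X).filter (fun AB ↦ ((AB.1 : ZMod n), (AB.2 : ZMod n)) ∈ R)).card +
        ((((box X).filter (fun AB : ℤ × ℤ ↦ 4 * AB.1 ^ 3 + 27 * AB.2 ^ 2 = 0)).card : ℝ) +
          (((box X).filter (fun AB ↦ AB ≠ (0, 0) ∧ ∃ p, p.Prime ∧ Y < p ∧ DvdCond p AB)).card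
            : ℝ)) := by exact_mod_cast h
    linarith [card_filter_disc_le hX, card_filter_exists_dvdCond_le hX hY]

/-! ## §E The limit -/

/-- The `ε/3` bookkeeping of the limit, on abstract real quantities: a count `NX` squeezed between
`T - E₁ - (E₂a + E₂b + E₂c)` and `T`, with `|T - Mn| ≤ E₀`, is within `ε` of `L` after division by
`P > 0` once `Mn/P` is within `ε/3` of `L`, `E₂a/P < ε/3` and `(E₀ + E₁ + (E₂b + E₂c))/P < ε/3`.
[folklore] -/
theorem abs_div_sub_lt_of_bounds {T NX Mn E₀ E₁ E₂a E₂b E₂c P M τ L ε : ℝ} (hP : 0 < P)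
    (hup : NX ≤ T) (hlow : T - E₁ - (E₂a + E₂b + E₂c) ≤ NX) (htr : |T - Mn| ≤ E₀)
    (hmain : Mn / P = M) (htailX : E₂a / P = τ) (herr : (E₀ + E₁ + (E₂b + E₂c)) / P < ε / 3)
    (hclose : |M - L| < ε / 3) (htail : τ < ε / 3) (hE : 0 ≤ E₁ + (E₂b + E₂c)) :
    |NX / P - L| < ε := by
  rw [abs_le] at htr
  rw [abs_lt] at hclose ⊢
  obtain ⟨htr1, htr2⟩ := htr
  obtain ⟨hc1, hc2⟩ := hclose
  have d1 : (T - E₁ - (E₂a + E₂b + E₂c)) / P ≤ NX / P := div_le_div_of_nonneg_right hlow hP.le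
  have d2 : NX / P ≤ T / P := div_le_div_of_nonneg_right hup hP.le
  have d3 : (Mn - E₀) / P ≤ T / P := div_le_div_of_nonneg_right (by linarith) hP.le
  have d4 : T / P ≤ (Mn + E₀) / P := div_le_div_of_nonneg_right (by linarith) hP.le
  have e1 : (T - E₁ - (E₂a + E₂b + E₂c)) / P = T / P - E₂a / P - (E₁ + (E₂b + E₂c)) / P := by
    field_simp
    ring
  have e2 : (Mn - E₀) / P = Mn / P - E₀ / P := sub_div _ _ _
  have e3 : (Mn + E₀) / P = Mn / P + E₀ / P := add_div _ _ _
  have e4 : (E₀ + E₁ + (E₂b + E₂c)) / P = E₀ / P + (E₁ + (E₂b + E₂c)) / P := by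
    rw [add_assoc, add_div]
  have hE' : 0 ≤ (E₁ + (E₂b + E₂c)) / P := div_nonneg hE hP.le
  have hE₀ : 0 ≤ E₀ / P := div_nonneg (by linarith) hP.le
  rw [hmain] at e2 e3
  rw [htailX] at e1
  constructor
  · linarith
  · linarith

/-- **Asymptotic count of the family cut by a residue condition at `p`**: for a prime `p`, a set `R`
of residue pairs modulo `p^m` all with `p ∤ A`,
`#{E_{A,B} : H < X, (A, B) mod p^m ∈ R} / X^{5/6} → (#R/p^{2m})/(1 − p⁻¹⁰) · c_F`. [folklore] -/
theorem tendsto_card_filter_residues_div {p : ℕ} (hp : p.Prime) (m : ℕ)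
    (R : Finset (ZMod (p ^ m) × ZMod (p ^ m)))
    (hR : ∀ AB : ℤ × ℤ, ((AB.1 : ZMod (p ^ m)), (AB.2 : ZMod (p ^ m))) ∈ R → ¬ (p : ℤ) ∣ AB.1) :
    Tendsto (fun X : ℕ ↦ (((heightFamilyBelow X).filter (fun AB ↦
        ((AB.1 : ZMod (p ^ m)), (AB.2 : ZMod (p ^ m))) ∈ R)).card : ℝ) / (X : ℝ) ^ (5 / 6 : ℝ))
      atTop (𝓝 ((R.card : ℝ) / ((p : ℝ) ^ m) ^ 2 / (1 - 1 / (p : ℝ) ^ 10) *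
        heightFamilyConstant)) := by
  unfold heightFamilyConstant
  set c₀ : ℝ := 4 / ((4 : ℝ) ^ (1 / 3 : ℝ) * (27 : ℝ) ^ (1 / 2 : ℝ)) with hc₀
  set Pinf : ℝ := ∏' p : Nat.Primes, (1 - 1 / ((p : ℕ) : ℝ) ^ 10) with hPinf
  set Lp : ℝ := 1 - 1 / (p : ℝ) ^ 10 with hLp
  set K : ℝ := (R.card : ℝ) / ((p : ℝ) ^ m) ^ 2 / Lp with hK
  have hc₀pos : 0 < c₀ := by rw [hc₀]; positivity
  have hp2 : (2 : ℝ) ≤ p := by exact_mod_cast hp.two_le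
  have hp0 : (0 : ℝ) < p := by linarith
  have hLppos : 0 < Lp := by
    rw [hLp, sub_pos, div_lt_one (pow_pos hp0 10)]
    exact one_lt_pow₀ (by linarith) (by norm_num)
  have hKnn : 0 ≤ K := by
    rw [hK]
    exact div_nonneg (div_nonneg (Nat.cast_nonneg _) (pow_nonneg (pow_nonneg hp0.le m) 2))
      hLppos.le
  have hKc₀ : 0 ≤ K * c₀ := mul_nonneg hKnn hc₀pos.le
  have h3 : (0 : ℝ) < 3 * (K * c₀ + 1) := by linarith
  rw [Metric.tendsto_atTop]
  intro ε hε
  -- choose `Y`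
  have hPY := tendsto_prod_primesLE
  rw [Metric.tendsto_atTop] at hPY
  obtain ⟨Y₁, hY₁⟩ := hPY (ε / (3 * (K * c₀ + 1))) (div_pos hε h3)
  obtain ⟨Y₂, hY₂⟩ : ∃ Y₂ : ℕ, 2 * c₀ / ((Y₂ : ℝ) + 1) < ε / 3 := by
    obtain ⟨n, hn⟩ := exists_nat_gt (2 * c₀ / (ε / 3))
    refine ⟨n, ?_⟩
    have hn1 : (0 : ℝ) < (n : ℝ) + 1 := by positivity
    rw [div_lt_iff₀ hn1]
    rw [div_lt_iff₀ (by positivity)] at hn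
    nlinarith
  set Y : ℕ := max (max Y₁ Y₂) p with hY
  have hYp : p ≤ Y := le_max_right _ _
  have hY1 : 1 ≤ Y := hp.one_le.trans hYp
  have hYY₁ : Y₁ ≤ Y := (le_max_left _ _).trans (le_max_left _ _)
  have hYY₂ : Y₂ ≤ Y := (le_max_right _ _).trans (le_max_left _ _)
  have hpS : p ∈ Nat.primesLE Y := Nat.mem_primesLE.mpr ⟨hYp, hp⟩
  -- the Euler factor at `p` removed
  have herase : ∏ q ∈ (Nat.primesLE Y).erase p, (1 - 1 / (q : ℝ) ^ 10) =
      (∏ q ∈ Nat.primesLE Y, (1 - 1 / (q : ℝ) ^ 10)) / Lp := by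
    rw [eq_div_iff hLppos.ne', hLp]
    exact Finset.prod_erase_mul _ _ hpS
  have hPclose : |K * c₀ * ∏ q ∈ Nat.primesLE Y, (1 - 1 / (q : ℝ) ^ 10) - K * c₀ * Pinf| < ε / 3 := by
    have := hY₁ Y hYY₁
    rw [Real.dist_eq] at this
    rw [← mul_sub, abs_mul, abs_of_nonneg hKc₀]
    calc K * c₀ * |∏ q ∈ Nat.primesLE Y, (1 - 1 / (q : ℝ) ^ 10) - Pinf|
        ≤ K * c₀ * (ε / (3 * (K * c₀ + 1))) := mul_le_mul_of_nonneg_left this.le hKc₀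
      _ < (K * c₀ + 1) * (ε / (3 * (K * c₀ + 1))) :=
          mul_lt_mul_of_pos_right (by linarith) (div_pos hε h3)
      _ = ε / 3 := by field_simp
  have htail : 2 * c₀ / ((Y : ℝ) + 1) < ε / 3 := by
    refine lt_of_le_of_lt ?_ hY₂
    have hY₂1 : (0 : ℝ) < (Y₂ : ℝ) + 1 := by positivity
    have : (Y₂ : ℝ) + 1 ≤ (Y : ℝ) + 1 := by
      have : (Y₂ : ℝ) ≤ Y := by exact_mod_cast hYY₂
      linarith
    exact div_le_div_of_nonneg_left (by linarith) hY₂1 this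
  -- the error terms tend to `0`
  set err : ℕ → ℝ := fun X ↦ (2 ^ (Nat.primesLE Y).card * (R.card * (4 * R₁ X + 4 * R₂ X + 4)) +
      (2 * R₂ X + 1) + (2 * R₁ X + 2 * R₂ X)) / (X : ℝ) ^ (5 / 6 : ℝ) with herr
  have herr0 : Tendsto err atTop (𝓝 0) := by
    have hA := ((tendsto_R₁_div.const_mul 4).add (tendsto_R₂_div.const_mul 4)).add
      (tendsto_one_div.const_mul 4)
    have hB := hA.const_mul ((2 : ℝ) ^ (Nat.primesLE Y).card * (R.card : ℝ))
    have hC := ((tendsto_R₂_div.const_mul 2).add tendsto_one_div).add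
      ((tendsto_R₁_div.const_mul 2).add (tendsto_R₂_div.const_mul 2))
    have h := hB.add hC
    simp only [mul_zero, add_zero] at h
    refine h.congr fun X ↦ ?_
    simp only [herr]
    ring
  rw [Metric.tendsto_atTop] at herr0
  obtain ⟨X₀, hX₀⟩ := herr0 (ε / 3) (by positivity)
  refine ⟨max X₀ 1, fun X hX ↦ ?_⟩
  have hX1 : 1 ≤ X := (le_max_right _ _).trans hX
  have hXX₀ : X₀ ≤ X := (le_max_left _ _).trans hX
  have herrX : |err X| < ε / 3 := by
    have := hX₀ X hXX₀; rwa [Real.dist_eq, sub_zero] at this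
  have hP : (0 : ℝ) < (X : ℝ) ^ (5 / 6 : ℝ) := Real.rpow_pos_of_pos (by exact_mod_cast hX1) _
  -- the two-sided bounds
  obtain ⟨hup, hlow⟩ := card_heightFamilyBelow_filter_mem_bounds hX1 hY1 R
  have htr := abs_card_filter_minimalLE_and_mem_sub_le hX1 Y hp m R hR
  have h4 := four_R₁R₂_div hX1
  rw [← hc₀] at h4
  have hmain : (R.card : ℝ) * (2 * R₁ X / (p ^ m : ℕ)) * (2 * R₂ X / (p ^ m : ℕ)) *
      (∏ q ∈ (Nat.primesLE Y).erase p, (1 - 1 / (q : ℝ) ^ 10)) / (X : ℝ) ^ (5 / 6 : ℝ) =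
      K * c₀ * ∏ q ∈ Nat.primesLE Y, (1 - 1 / (q : ℝ) ^ 10) := by
    rw [herase, hK, ← h4]
    push_cast
    ring
  have htailX : (8 * (R₁ X * R₂ X) / ((Y : ℝ) + 1)) / (X : ℝ) ^ (5 / 6 : ℝ) =
      2 * c₀ / ((Y : ℝ) + 1) := by
    rw [← h4]
    ring
  have herr1 := (abs_lt.mp herrX).2
  simp only [herr] at herr1
  rw [Real.dist_eq, show K * (c₀ * Pinf) = K * c₀ * Pinf by ring]
  exact abs_div_sub_lt_of_bounds hP hup hlow htr hmain htailX herr1 hPclose htail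
    (by linarith only [R₁_nonneg X, R₂_nonneg X])

end HeightCount

open HeightCount in
/-- **The local-density formula at one prime (Bhargava–Skinner–Zhang §3.1, from [BS2]; proved).**
For a prime `p`, `m ≥ 0` and a set `R` of residue pairs `(A, B) mod p^m` all of whose members have
`p ∤ A`, the proportion, among the elliptic curves `E_{A,B}` of naive height `< X` (in their unique
model with `q⁴ ∤ A` or `q⁶ ∤ B` at every prime `q`), of those with `(A, B) mod p^m ∈ R` tends, as
`X → ∞`, to `#R / p^{2m} / (1 - p⁻¹⁰)`: the `p`-adic measure of the residue set divided by the measure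
`1 - p⁻¹⁰` of `{(A, B) ∈ ℤ_p² : p⁶ ∤ B whenever p⁴ ∣ A}` ("`μ_ℓ(F) = μ_ℓ(Σ_ℓ)` equals the measure of
`Σ_ℓ ⊂ ℤ_ℓ²` divided by `1 - ℓ⁻¹⁰`", source §3.1), all other local densities being those of the
whole family. [cite: BhargavaSkinnerZhang2014, §3.1 (density of a family defined by congruence conditions, from [BS2])] -/
theorem hasHeightDensity_residues {p : ℕ} (hp : p.Prime) (m : ℕ)
    (R : Finset (ZMod (p ^ m) × ZMod (p ^ m)))
    (hR : ∀ AB : ℤ × ℤ, ((AB.1 : ZMod (p ^ m)), (AB.2 : ZMod (p ^ m))) ∈ R → ¬ (p : ℤ) ∣ AB.1) :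
    HasHeightDensity (fun AB ↦ ((AB.1 : ZMod (p ^ m)), (AB.2 : ZMod (p ^ m))) ∈ R)
      ((R.card : ℝ) / ((p : ℝ) ^ m) ^ 2 / (1 - 1 / (p : ℝ) ^ 10)) := by
  unfold HasHeightDensity
  have hnum := tendsto_card_filter_residues_div hp m R hR
  have hden : Tendsto (fun X : ℕ ↦ ((heightFamilyBelow X).card : ℝ) / (X : ℝ) ^ (5 / 6 : ℝ)) atTop
      (𝓝 heightFamilyConstant) := card_heightFamilyBelow_asymptotic_holds
  have hq := hnum.div hden heightFamilyConstant_pos.ne'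
  rw [mul_div_assoc, div_self heightFamilyConstant_pos.ne', mul_one] at hq
  refine hq.congr' ?_
  filter_upwards [eventually_ge_atTop 1] with X hX
  have hP : (0 : ℝ) < (X : ℝ) ^ (5 / 6 : ℝ) := Real.rpow_pos_of_pos (by exact_mod_cast hX) _
  simp only [Pi.div_apply]
  rw [heightProportion_eq_card_div, div_div_div_cancel_right₀ hP.ne']

/-- **Lemma 17 of Bhargava–Skinner–Zhang (proved): `μ(S₀(5)) = 4·5¹⁰/(5(5¹⁰ - 1)) (> .8)`.** The
curves `E_{A,B}` with `5 ∤ A` — by the source's proof of Lemma 17 exactly the curves with good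
ordinary or multiplicative reduction at `5` (`E_{A,B}` is minimal at `5`; good reduction iff
`5 ∤ Δ(A,B)`, then ordinary iff `5 ∤ 2A`, the coefficient of `x⁴` in `(x³ + Ax + B)²`; multiplicative
iff `5 ∣ Δ(A,B)`, `5 ∤ A`), i.e. its family `S₀(5)` — have height density
`(4/5)(1 - 5⁻¹⁰)⁻¹ = 4·5¹⁰/(5(5¹⁰ - 1))`: the case `p = 5`, `m = 1`, `R = {(a, b) : a ≠ 0}` (`#R = 20`)
of `hasHeightDensity_residues`. [cite: BhargavaSkinnerZhang2014, Lemma 17] -/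
theorem hasHeightDensity_not_five_dvd :
    HasHeightDensity (fun AB : ℤ × ℤ ↦ ¬ (5 : ℤ) ∣ AB.1) (4 * 5 ^ 10 / (5 * (5 ^ 10 - 1))) := by
  set R : Finset (ZMod (5 ^ 1) × ZMod (5 ^ 1)) := Finset.univ.filter (fun r ↦ r.1 ≠ 0) with hRdef
  have hmem : ∀ AB : ℤ × ℤ,
      (((AB.1 : ZMod (5 ^ 1)), (AB.2 : ZMod (5 ^ 1))) ∈ R) ↔ ¬ (5 : ℤ) ∣ AB.1 := by
    intro AB
    simp only [hRdef, Finset.mem_filter, Finset.mem_univ, true_and, ne_eq,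
      ZMod.intCast_zmod_eq_zero_iff_dvd]
    norm_num
  have hR : ∀ AB : ℤ × ℤ, ((AB.1 : ZMod (5 ^ 1)), (AB.2 : ZMod (5 ^ 1))) ∈ R →
      ¬ ((5 : ℕ) : ℤ) ∣ AB.1 := fun AB h ↦ by exact_mod_cast (hmem AB).mp h
  have hcard : R.card = 20 := by
    rw [hRdef]; decide
  have h := hasHeightDensity_residues (by norm_num : (5 : ℕ).Prime) 1 R hR
  have hfun : (fun AB : ℤ × ℤ ↦ ((AB.1 : ZMod (5 ^ 1)), (AB.2 : ZMod (5 ^ 1))) ∈ R) =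
      (fun AB : ℤ × ℤ ↦ ¬ (5 : ℤ) ∣ AB.1) := funext fun AB ↦ propext (hmem AB)
  have hconst : ((R.card : ℕ) : ℝ) / (((5 : ℕ) : ℝ) ^ 1) ^ 2 / (1 - 1 / ((5 : ℕ) : ℝ) ^ 10) =
      4 * 5 ^ 10 / (5 * (5 ^ 10 - 1)) := by
    rw [hcard]; norm_num
  rwa [hfun, hconst] at h

/-- Numerical form of Lemma 17: the density of `S₀(5)` exceeds `.8` (source: "`> .8`"). [cite: BhargavaSkinnerZhang2014, Lemma 17] -/
theorem heightDensityGE_not_five_dvd :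
    HeightDensityGE (fun AB : ℤ × ℤ ↦ ¬ (5 : ℤ) ∣ AB.1) 0.8 := fun ε hε ↦
  (hasHeightDensity_not_five_dvd.heightDensityGE ε hε).mono fun _ hX ↦ by
    have h0 : (0.8 : ℝ) ≤ 4 * 5 ^ 10 / (5 * (5 ^ 10 - 1)) := by norm_num
    linarith

/-! ### The residue classes modulo `5` of the proof of Lemma 18: `Σ₅^g`, the multiplicative
classes, `Σ₅^spl ⊆ {(3, ±1)}`, `Σ₅^ns ⊆ {(2, ±2)}` -/

/-- **`μ₅(Σ₅^g) = 16/25 · (1 - 5⁻¹⁰)⁻¹`** (proof of Lemma 18 of the source: "`Σ₅^g` is the set of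
those `(A,B) ∈ ℤ₅²` with `5 ∤ A` and `5 ∤ Δ(A,B)` (this is the set of `(A,B)` such that `E_{A,B}`
has good ordinary reduction at `5`) … Clearly, `μ₅(Σ₅^g) = 16/25 · (1 - 1/5¹⁰)⁻¹`"): the height
density of `{5 ∤ A, 5 ∤ 4A³ + 27B²}` is `16/25 · (1 - 5⁻¹⁰)⁻¹ = 16·5¹⁰/(25(5¹⁰ - 1))` (`16` of the
`25` residue pairs modulo `5`; `Δ(A,B) = -16(4A³ + 27B²)`). That this set is exactly the set of
family members with good ordinary reduction at `5` is the content of the siblings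
`LeadingTermBSZReductionTypesProofs` (`hasGoodReductionAtPrime_shortWeierstrass_iff_of_isInHeightFamily`)
and `LeadingTermBSZOrdinaryProofs` (`5 ∣ a_5 ↔ 5 ∣ A`). [cite: BhargavaSkinnerZhang2014, Lemma 18 (proof)] -/
theorem hasHeightDensity_sigma_good_five :
    HasHeightDensity (fun AB : ℤ × ℤ ↦ ¬ (5 : ℤ) ∣ AB.1 ∧ ¬ (5 : ℤ) ∣ 4 * AB.1 ^ 3 + 27 * AB.2 ^ 2)
      (16 * 5 ^ 10 / (25 * (5 ^ 10 - 1))) := by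
  set R : Finset (ZMod (5 ^ 1) × ZMod (5 ^ 1)) :=
    Finset.univ.filter (fun r ↦ r.1 ≠ 0 ∧ 4 * r.1 ^ 3 + 27 * r.2 ^ 2 ≠ 0) with hRdef
  have hmem : ∀ AB : ℤ × ℤ, (((AB.1 : ZMod (5 ^ 1)), (AB.2 : ZMod (5 ^ 1))) ∈ R) ↔
      (¬ (5 : ℤ) ∣ AB.1 ∧ ¬ (5 : ℤ) ∣ 4 * AB.1 ^ 3 + 27 * AB.2 ^ 2) := by
    intro AB
    simp only [hRdef, Finset.mem_filter, Finset.mem_univ, true_and, ne_eq]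
    rw [show (4 * (AB.1 : ZMod (5 ^ 1)) ^ 3 + 27 * (AB.2 : ZMod (5 ^ 1)) ^ 2) =
        ((4 * AB.1 ^ 3 + 27 * AB.2 ^ 2 : ℤ) : ZMod (5 ^ 1)) by push_cast; ring,
      ZMod.intCast_zmod_eq_zero_iff_dvd, ZMod.intCast_zmod_eq_zero_iff_dvd]
    norm_num
  have hR : ∀ AB : ℤ × ℤ, ((AB.1 : ZMod (5 ^ 1)), (AB.2 : ZMod (5 ^ 1))) ∈ R →
      ¬ ((5 : ℕ) : ℤ) ∣ AB.1 := fun AB h ↦ by exact_mod_cast ((hmem AB).mp h).1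
  have hcard : R.card = 16 := by
    rw [hRdef]; decide
  have h := hasHeightDensity_residues (by norm_num : (5 : ℕ).Prime) 1 R hR
  have hfun : (fun AB : ℤ × ℤ ↦ ((AB.1 : ZMod (5 ^ 1)), (AB.2 : ZMod (5 ^ 1))) ∈ R) =
      (fun AB : ℤ × ℤ ↦ ¬ (5 : ℤ) ∣ AB.1 ∧ ¬ (5 : ℤ) ∣ 4 * AB.1 ^ 3 + 27 * AB.2 ^ 2) :=
    funext fun AB ↦ propext (hmem AB)
  have hconst : ((R.card : ℕ) : ℝ) / (((5 : ℕ) : ℝ) ^ 1) ^ 2 / (1 - 1 / ((5 : ℕ) : ℝ) ^ 10) =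
      16 * 5 ^ 10 / (25 * (5 ^ 10 - 1)) := by
    rw [hcard]; norm_num
  rwa [hfun, hconst] at h

/-- **The multiplicative classes at `5` have density `4/25 · (1 - 5⁻¹⁰)⁻¹`**: the height density of
`{5 ∤ A, 5 ∣ 4A³ + 27B²}` (the family members with multiplicative reduction at `5`,
`hasMultiplicativeReductionAtPrime_shortWeierstrass_iff_of_isInHeightFamily` of
`LeadingTermBSZReductionTypesProofs`; the `4` residue pairs `(2, ±2)`, `(3, ±1)` modulo `5` of the
proof of Lemma 18) is `4·5¹⁰/(25(5¹⁰ - 1))`; with `hasHeightDensity_sigma_good_five` this splits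
`μ(S₀(5)) = (16 + 4)/25 · (1 - 5⁻¹⁰)⁻¹` (`hasHeightDensity_not_five_dvd`).
[cite: BhargavaSkinnerZhang2014, Lemma 18 (proof)] -/
theorem hasHeightDensity_mult_five :
    HasHeightDensity (fun AB : ℤ × ℤ ↦ ¬ (5 : ℤ) ∣ AB.1 ∧ (5 : ℤ) ∣ 4 * AB.1 ^ 3 + 27 * AB.2 ^ 2)
      (4 * 5 ^ 10 / (25 * (5 ^ 10 - 1))) := by
  set R : Finset (ZMod (5 ^ 1) × ZMod (5 ^ 1)) :=
    Finset.univ.filter (fun r ↦ r.1 ≠ 0 ∧ 4 * r.1 ^ 3 + 27 * r.2 ^ 2 = 0) with hRdef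
  have hmem : ∀ AB : ℤ × ℤ, (((AB.1 : ZMod (5 ^ 1)), (AB.2 : ZMod (5 ^ 1))) ∈ R) ↔
      (¬ (5 : ℤ) ∣ AB.1 ∧ (5 : ℤ) ∣ 4 * AB.1 ^ 3 + 27 * AB.2 ^ 2) := by
    intro AB
    simp only [hRdef, Finset.mem_filter, Finset.mem_univ, true_and, ne_eq]
    rw [show (4 * (AB.1 : ZMod (5 ^ 1)) ^ 3 + 27 * (AB.2 : ZMod (5 ^ 1)) ^ 2) =
        ((4 * AB.1 ^ 3 + 27 * AB.2 ^ 2 : ℤ) : ZMod (5 ^ 1)) by push_cast; ring,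
      ZMod.intCast_zmod_eq_zero_iff_dvd, ZMod.intCast_zmod_eq_zero_iff_dvd]
    norm_num
  have hR : ∀ AB : ℤ × ℤ, ((AB.1 : ZMod (5 ^ 1)), (AB.2 : ZMod (5 ^ 1))) ∈ R →
      ¬ ((5 : ℕ) : ℤ) ∣ AB.1 := fun AB h ↦ by exact_mod_cast ((hmem AB).mp h).1
  have hcard : R.card = 4 := by
    rw [hRdef]; decide
  have h := hasHeightDensity_residues (by norm_num : (5 : ℕ).Prime) 1 R hR
  have hfun : (fun AB : ℤ × ℤ ↦ ((AB.1 : ZMod (5 ^ 1)), (AB.2 : ZMod (5 ^ 1))) ∈ R) =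
      (fun AB : ℤ × ℤ ↦ ¬ (5 : ℤ) ∣ AB.1 ∧ (5 : ℤ) ∣ 4 * AB.1 ^ 3 + 27 * AB.2 ^ 2) :=
    funext fun AB ↦ propext (hmem AB)
  have hconst : ((R.card : ℕ) : ℝ) / (((5 : ℕ) : ℝ) ^ 1) ^ 2 / (1 - 1 / ((5 : ℕ) : ℝ) ^ 10) =
      4 * 5 ^ 10 / (25 * (5 ^ 10 - 1)) := by
    rw [hcard]; norm_num
  rwa [hfun, hconst] at h

/-- **The classes `A ≡ 3`, `B ≡ ±1 (mod 5)` (which contain `Σ₅^spl`) have density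
`2/25 · (1 - 5⁻¹⁰)⁻¹`**, the leading term of the printed
`μ₅(Σ₅^spl) = (1 - 5⁻¹⁰)⁻¹ Σ_{5 ∤ k} (…)/5^{k+3}` before the `ord₅Δ` and `𝓛` refinements (these are
the family members with split multiplicative reduction at `5`: `LeadingTermBSZSplitReductionProofs`).
Residues are written as casts to `ZMod 5` (`B ≡ ±1 ↔ (B : ZMod 5) ∈ {1, 4}`).
[cite: BhargavaSkinnerZhang2014, Lemma 18 (proof)] -/
theorem hasHeightDensity_split_classes_five :
    HasHeightDensity (fun AB : ℤ × ℤ ↦ (AB.1 : ZMod 5) = 3 ∧ ((AB.2 : ZMod 5) = 1 ∨ (AB.2 : ZMod 5) = 4))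
      (2 * 5 ^ 10 / (25 * (5 ^ 10 - 1))) := by
  set R : Finset (ZMod (5 ^ 1) × ZMod (5 ^ 1)) :=
    Finset.univ.filter (fun r ↦ r.1 = 3 ∧ (r.2 = 1 ∨ r.2 = 4)) with hRdef
  have hmem : ∀ AB : ℤ × ℤ, (((AB.1 : ZMod (5 ^ 1)), (AB.2 : ZMod (5 ^ 1))) ∈ R) ↔
      ((AB.1 : ZMod 5) = 3 ∧ ((AB.2 : ZMod 5) = 1 ∨ (AB.2 : ZMod 5) = 4)) := by
    intro AB
    simp only [hRdef, Finset.mem_filter, Finset.mem_univ, true_and]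
  have hR : ∀ AB : ℤ × ℤ, ((AB.1 : ZMod (5 ^ 1)), (AB.2 : ZMod (5 ^ 1))) ∈ R →
      ¬ ((5 : ℕ) : ℤ) ∣ AB.1 := fun AB h ↦ by
    have h3 := ((hmem AB).mp h).1
    intro h5
    have h0 := (ZMod.intCast_zmod_eq_zero_iff_dvd AB.1 5).mpr (by exact_mod_cast h5)
    rw [h0] at h3
    exact absurd h3 (by decide)
  have hcard : R.card = 2 := by
    rw [hRdef]; decide
  have h := hasHeightDensity_residues (by norm_num : (5 : ℕ).Prime) 1 R hR
  have hfun : (fun AB : ℤ × ℤ ↦ ((AB.1 : ZMod (5 ^ 1)), (AB.2 : ZMod (5 ^ 1))) ∈ R) =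
      (fun AB : ℤ × ℤ ↦ (AB.1 : ZMod 5) = 3 ∧ ((AB.2 : ZMod 5) = 1 ∨ (AB.2 : ZMod 5) = 4)) :=
    funext fun AB ↦ propext (hmem AB)
  have hconst : ((R.card : ℕ) : ℝ) / (((5 : ℕ) : ℝ) ^ 1) ^ 2 / (1 - 1 / ((5 : ℕ) : ℝ) ^ 10) =
      2 * 5 ^ 10 / (25 * (5 ^ 10 - 1)) := by
    rw [hcard]; norm_num
  rwa [hfun, hconst] at h

/-- **The classes `A ≡ 2`, `B ≡ ±2 (mod 5)` (which contain `Σ₅^ns`) have density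
`2/25 · (1 - 5⁻¹⁰)⁻¹`**, the `k`-summed leading term of the printed
`μ₅(Σ₅^ns) = (1 - 5⁻¹⁰)⁻¹ Σ_{5 ∤ k} 2(5-1)/5^{k+2} = 2/25 (1 - 4/(5⁵-1)) (1 - 5⁻¹⁰)⁻¹` before the
refinement `5 ∤ ord₅Δ` (these are the family members with non-split multiplicative reduction at `5`:
`LeadingTermBSZSplitReductionProofs`). [cite: BhargavaSkinnerZhang2014, Lemma 18 (proof)] -/
theorem hasHeightDensity_nonsplit_classes_five :
    HasHeightDensity (fun AB : ℤ × ℤ ↦ (AB.1 : ZMod 5) = 2 ∧ ((AB.2 : ZMod 5) = 2 ∨ (AB.2 : ZMod 5) = 3))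
      (2 * 5 ^ 10 / (25 * (5 ^ 10 - 1))) := by
  set R : Finset (ZMod (5 ^ 1) × ZMod (5 ^ 1)) :=
    Finset.univ.filter (fun r ↦ r.1 = 2 ∧ (r.2 = 2 ∨ r.2 = 3)) with hRdef
  have hmem : ∀ AB : ℤ × ℤ, (((AB.1 : ZMod (5 ^ 1)), (AB.2 : ZMod (5 ^ 1))) ∈ R) ↔
      ((AB.1 : ZMod 5) = 2 ∧ ((AB.2 : ZMod 5) = 2 ∨ (AB.2 : ZMod 5) = 3)) := by
    intro AB
    simp only [hRdef, Finset.mem_filter, Finset.mem_univ, true_and]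
  have hR : ∀ AB : ℤ × ℤ, ((AB.1 : ZMod (5 ^ 1)), (AB.2 : ZMod (5 ^ 1))) ∈ R →
      ¬ ((5 : ℕ) : ℤ) ∣ AB.1 := fun AB h ↦ by
    have h2 := ((hmem AB).mp h).1
    intro h5
    have h0 := (ZMod.intCast_zmod_eq_zero_iff_dvd AB.1 5).mpr (by exact_mod_cast h5)
    rw [h0] at h2
    exact absurd h2 (by decide)
  have hcard : R.card = 2 := by
    rw [hRdef]; decide
  have h := hasHeightDensity_residues (by norm_num : (5 : ℕ).Prime) 1 R hR
  have hfun : (fun AB : ℤ × ℤ ↦ ((AB.1 : ZMod (5 ^ 1)), (AB.2 : ZMod (5 ^ 1))) ∈ R) =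
      (fun AB : ℤ × ℤ ↦ (AB.1 : ZMod 5) = 2 ∧ ((AB.2 : ZMod 5) = 2 ∨ (AB.2 : ZMod 5) = 3)) :=
    funext fun AB ↦ propext (hmem AB)
  have hconst : ((R.card : ℕ) : ℝ) / (((5 : ℕ) : ℝ) ^ 1) ^ 2 / (1 - 1 / ((5 : ℕ) : ℝ) ^ 10) =
      2 * 5 ^ 10 / (25 * (5 ^ 10 - 1)) := by
    rw [hcard]; norm_num
  rwa [hfun, hconst] at h

end Literature.NumberTheory.EllipticCurves
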